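import Mathlib
import Summits.Ventures.HodgeRepro2.Tier7.Line1.SepAlgebra

/-!
# Tier7/Line1/SepModule — the stable subspaces of the model `M = Fin 2 → U` of `H¹⁰·H¹⁰`

The SEPARATING DATUM of t7-L1-p2 (LINE L1, residual probe), module-theoretic half, part 1. In the datum
`H¹⁰·H¹⁰ ≅ U ⊗ ℂ² = (Fin 2 → U)` with `U = W⁰ ⊕ Wˢ` (`W⁰ = Wmod 0`, `Wˢ = Wmod sq`), the Hecke generators acting by
the flips and signs on `U` (componentwise) and by the swap `e₀ ↔ e₁` and the sign `e₁ ↦ -e₁` on the index. This file: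
the generators on `M`, the stability predicate `StableM`, the two pieces `PW 0 = Fin 2 → W⁰` and `PW sq = Fin 2 → Wˢ`
(stable, complementary), and the FIX-RELATION ARGUMENT: a stable subspace meeting neither piece is zero, and an
equivariant map from one piece to the other is zero (`Hom(W⁰ ⊗ ℂ², Wˢ ⊗ ℂ²) = 0` both ways). Irreducibility of the
pieces is `SepModuleIrred`. Author: t7-L1-p2 (prover-pub-hodge-repro2-t7-L1-p2-g0-0). §8(d): NO.
-/

namespace Summit.Ventures.HodgeRepro2.Tier7.Line1.Sep

open Finset

noncomputable section

/-- the model of `H¹⁰·H¹⁰`: two copies of `U`, indexed by the holomorphic classes `e₀, e₁` -/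
abbrev M := Fin 2 → U

/-- the flip at `n`, componentwise -/
def flipM (n : ℕ) : M ≃ₗ[ℂ] M := LinearEquiv.piCongrRight fun _ => flipU n

/-- the sign at `n`, componentwise -/
def sgnM (n : ℕ) : M ≃ₗ[ℂ] M := LinearEquiv.piCongrRight fun _ => sgnU n

/-- `flipM` unfolded -/
@[simp] theorem flipM_apply (n : ℕ) (x : M) (k : Fin 2) : flipM n x k = flipU n (x k) := rfl

/-- `sgnM` unfolded -/
@[simp] theorem sgnM_apply (n : ℕ) (x : M) (k : Fin 2) : sgnM n x k = sgnU n (x k) := rfl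

/-- the swap `e₀ ↔ e₁` -/
def swapM : M ≃ₗ[ℂ] M where
  toFun x k := x (Equiv.swap 0 1 k)
  invFun x k := x (Equiv.swap 0 1 k)
  left_inv x := by funext k; simp
  right_inv x := by funext k; simp
  map_add' _ _ := rfl
  map_smul' _ _ := rfl

/-- `swapM` unfolded -/
@[simp] theorem swapM_apply (x : M) (k : Fin 2) : swapM x k = x (Equiv.swap 0 1 k) := rfl

/-- the signs `![1, -1]` -/
def signK : Fin 2 → ℂ := ![1, -1]

/-- `signK k * signK k = 1` -/
theorem signK_mul_self (k : Fin 2) : signK k * signK k = 1 := by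
  fin_cases k <;> simp [signK]

/-- the sign `e₁ ↦ -e₁` -/
def signM : M ≃ₗ[ℂ] M where
  toFun x k := signK k • x k
  invFun x k := signK k • x k
  left_inv x := by funext k; simp [smul_smul, signK_mul_self]
  right_inv x := by funext k; simp [smul_smul, signK_mul_self]
  map_add' x y := by funext k; simp [smul_add]
  map_smul' c x := by funext k; simp [smul_comm c]

/-- `signM` unfolded -/
@[simp] theorem signM_apply (x : M) (k : Fin 2) : signM x k = signK k • x k := rfl

/-- `signK 0 = 1` -/
@[simp] theorem signK_zero : signK 0 = 1 := rfl

/-- `signK 1 = -1` -/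
@[simp] theorem signK_one : signK 1 = -1 := rfl

/-- the generators are involutions -/
theorem flipM_flipM (n : ℕ) (x : M) : flipM n (flipM n x) = x := by
  funext k; apply Subtype.ext; simp [flip_flip]

/-- the generators are involutions -/
theorem sgnM_sgnM (n : ℕ) (x : M) : sgnM n (sgnM n x) = x := by
  funext k; apply Subtype.ext; simp [sgn_sgn]

/-- the generators are involutions -/
theorem swapM_swapM (x : M) : swapM (swapM x) = x := by
  funext k; simp

/-- the generators are involutions -/
theorem signM_signM (x : M) : signM (signM x) = x := by
  funext k; simp [smul_smul, signK_mul_self]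

/-! ## Stability and the two pieces -/

/-- a subspace of `M` stable under the four kinds of generators -/
structure StableM (X : Submodule ℂ M) : Prop where
  /-- stable under the flips -/
  flip_mem : ∀ n, ∀ x ∈ X, flipM n x ∈ X
  /-- stable under the signs -/
  sgn_mem : ∀ n, ∀ x ∈ X, sgnM n x ∈ X
  /-- stable under the swap -/
  swap_mem : ∀ x ∈ X, swapM x ∈ X
  /-- stable under the index sign -/
  sign_mem : ∀ x ∈ X, signM x ∈ X

/-- `Fin 2 → Wmod s` inside `M` -/
def PW (s : ℕ → ℂ) : Submodule ℂ M := Submodule.pi Set.univ fun _ => (Wmod s).comap Usub.subtype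

/-- membership in `PW s` -/
theorem mem_PW {s : ℕ → ℂ} {x : M} : x ∈ PW s ↔ ∀ k, (x k : Ω → ℂ) ∈ Wmod s := by
  simp [PW, Submodule.mem_pi]

/-- the pieces are stable -/
theorem stableM_PW (s : ℕ → ℂ) : StableM (PW s) where
  flip_mem n x hx := mem_PW.2 fun k => by
    simpa using (Wmod_stable s).flip_mem n _ (mem_PW.1 hx k)
  sgn_mem n x hx := mem_PW.2 fun k => by
    simpa using (Wmod_stable s).sgn_mem n _ (mem_PW.1 hx k)
  swap_mem x hx := mem_PW.2 fun k => by simpa using mem_PW.1 hx (Equiv.swap 0 1 k)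
  sign_mem x hx := mem_PW.2 fun k => by
    simpa using (Wmod s).smul_mem (signK k) (mem_PW.1 hx k)

/-- the two pieces are independent -/
theorem PW_zero_inf_PW_sq : PW 0 ⊓ PW sq = ⊥ := by
  rw [eq_bot_iff]
  rintro x ⟨hx0, hxs⟩
  rw [Submodule.mem_bot]
  funext k
  apply Subtype.ext
  have : (x k : Ω → ℂ) ∈ Wmod 0 ⊓ Wmod sq := ⟨mem_PW.1 hx0 k, mem_PW.1 hxs k⟩
  rw [Wmod_zero_inf_eq_bot sq_ne_zero, Submodule.mem_bot] at this
  simpa using this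

/-- the two pieces span -/
theorem PW_zero_sup_PW_sq : PW 0 ⊔ PW sq = ⊤ := by
  rw [eq_top_iff]
  intro x _
  have hdec : ∀ k, ∃ a b : Ω → ℂ, a ∈ Wmod 0 ∧ b ∈ Wmod sq ∧ (x k : Ω → ℂ) = a + b := fun k => by
    obtain ⟨a, ha, b, hb, h⟩ := Submodule.mem_sup.1 (x k).2
    exact ⟨a, b, ha, hb, h.symm⟩
  choose a b ha hb hab using hdec
  refine Submodule.mem_sup.2 ⟨fun k => ⟨a k, Wmod_zero_le_Usub (ha k)⟩, mem_PW.2 fun k => ha k,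
    fun k => ⟨b k, Wmod_sq_le_Usub (hb k)⟩, mem_PW.2 fun k => hb k, ?_⟩
  funext k
  apply Subtype.ext
  simp [hab k]

/-! ## The Fix-relation argument -/

/-- `proj` is additive -/
theorem proj_add (n : ℕ) (f g : Ω → ℂ) : proj n (f + g) = proj n f + proj n g := by
  funext ω; simp only [proj, Pi.add_apply]; split_ifs <;> simp

/-- `projc` is additive -/
theorem projc_add (n : ℕ) (f g : Ω → ℂ) : projc n (f + g) = projc n f + projc n g := by
  funext ω; simp only [projc, Pi.add_apply]; split_ifs <;> simp

/-- `flip` preserves differences -/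
theorem flip_sub (n : ℕ) (f g : Ω → ℂ) : flip n (f - g) = flip n f - flip n g := by
  funext ω; simp [flip]

/-- the relation operator `R_n y = X_n π_n^- y - s_n π_n^+ y` on `M`, written with the generators -/
def relM (n : ℕ) (x : M) : M :=
  flipM n ((1 / 2 : ℂ) • (x + (-1 : ℂ) • sgnM n x)) + (-(sq n) * (1 / 2)) • (x + sgnM n x)

/-- `relM` componentwise -/
theorem relM_apply_coe (n : ℕ) (x : M) (k : Fin 2) :
    (relM n x k : Ω → ℂ) = flip n (projc n (x k)) - sq n • proj n (x k) := by
  funext ω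
  simp only [relM, Pi.add_apply, Pi.smul_apply, Submodule.coe_add, Submodule.coe_smul, flipM_apply,
    sgnM_apply, flipU_apply_coe, sgnU_apply_coe, Pi.sub_apply, flip, sgn, proj, projc, smul_eq_mul]
  split_ifs <;> ring

/-- a stable subspace is stable under `relM` -/
theorem StableM.relM_mem {X : Submodule ℂ M} (hX : StableM X) (n : ℕ) {x : M} (hx : x ∈ X) :
    relM n x ∈ X :=
  X.add_mem (hX.flip_mem n _ (X.smul_mem _ (X.add_mem hx (X.smul_mem _ (hX.sgn_mem n x hx)))))
    (X.smul_mem _ (X.add_mem hx (hX.sgn_mem n x hx)))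

/-- `relM n` kills the level-`N` part of `PW sq`, `n ∉ N` -/
theorem relM_eq_zero {N : Finset ℕ} {x : M} (hx : ∀ k, (x k : Ω → ℂ) ∈ level sq N) {n : ℕ}
    (hn : n ∉ N) : relM n x = 0 := by
  funext k; apply Subtype.ext
  rw [relM_apply_coe, flip_projc_eq (hx k) hn]; simp

/-- `relM n = -(sq n)` on the level-`N` part of `PW 0`, `n ∉ N` -/
theorem relM_eq_neg_smul {N : Finset ℕ} {x : M} (hx : ∀ k, (x k : Ω → ℂ) ∈ level 0 N) {n : ℕ}
    (hn : n ∉ N) : relM n x = -(sq n • x) := by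
  funext k; apply Subtype.ext
  rw [relM_apply_coe, projc_eq_zero_of_level_zero (hx k) hn, proj_eq_self_of_level_zero (hx k) hn,
    flip_zero]
  simp

/-- `relM` is additive -/
theorem relM_add (n : ℕ) (x y : M) : relM n (x + y) = relM n x + relM n y := by
  funext k; apply Subtype.ext
  simp only [relM_apply_coe, Pi.add_apply, Submodule.coe_add, projc_add, proj_add, flip_add, smul_add]
  abel

/-- the components of an element of `PW s` lie in a common level -/
theorem exists_level_of_mem_PW {s : ℕ → ℂ} {x : M} (hx : x ∈ PW s) :
    ∃ N : Finset ℕ, ∀ k, (x k : Ω → ℂ) ∈ level s N := by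
  have h : ∀ k, ∃ N, (x k : Ω → ℂ) ∈ level s N := fun k => mem_Wmod_iff.1 (mem_PW.1 hx k)
  choose N hN using h
  exact ⟨Finset.univ.biUnion N, fun k =>
    level_mono (Finset.subset_biUnion_of_mem N (Finset.mem_univ k)) (hN k)⟩

/-- THE FIX-RELATION ARGUMENT: a stable subspace meeting neither piece is zero -/
theorem eq_bot_of_inf_eq_bot {X : Submodule ℂ M} (hX : StableM X) (hA : X ⊓ PW 0 = ⊥)
    (hB : X ⊓ PW sq = ⊥) : X = ⊥ := by
  rw [eq_bot_iff]
  intro x hx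
  have hx' : x ∈ PW 0 ⊔ PW sq := by rw [PW_zero_sup_PW_sq]; exact Submodule.mem_top
  obtain ⟨a, ha, b, hb, rfl⟩ := Submodule.mem_sup.1 hx'
  obtain ⟨Na, hNa⟩ := exists_level_of_mem_PW ha
  obtain ⟨Nb, hNb⟩ := exists_level_of_mem_PW hb
  obtain ⟨n, hn⟩ := Infinite.exists_notMem_finset (Na ∪ Nb)
  have hna : n ∉ Na := fun h => hn (mem_union_left _ h)
  have hnb : n ∉ Nb := fun h => hn (mem_union_right _ h)
  have hR : relM n (a + b) = -(sq n • a) := by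
    rw [relM_add, relM_eq_zero hNb hnb, relM_eq_neg_smul hNa hna, add_zero]
  have haX : a ∈ X := by
    have h1 : -(sq n • a) ∈ X := hR ▸ hX.relM_mem n hx
    have h2 : sq n • a ∈ X := (Submodule.neg_mem_iff X).1 h1
    have h3 := X.smul_mem (sq n)⁻¹ h2
    rwa [smul_smul, inv_mul_cancel₀ (sq_ne_zero n), one_smul] at h3
  have ha0 : a = 0 := by
    have : a ∈ X ⊓ PW 0 := ⟨haX, ha⟩
    rwa [hA, Submodule.mem_bot] at this
  have hbX : b ∈ X := by
    have := X.sub_mem hx haX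
    rwa [add_sub_cancel_left] at this
  have hb0 : b = 0 := by
    have : b ∈ X ⊓ PW sq := ⟨hbX, hb⟩
    rwa [hB, Submodule.mem_bot] at this
  rw [Submodule.mem_bot, ha0, hb0, add_zero]

/-- an equivariant linear map out of a piece commutes with `relM` -/
theorem map_relM {s : ℕ → ℂ} (φ : ↥(PW s) →ₗ[ℂ] M)
    (hflip : ∀ n (x : PW s), φ ⟨flipM n x, (stableM_PW s).flip_mem n x x.2⟩ = flipM n (φ x))
    (hsgn : ∀ n (x : PW s), φ ⟨sgnM n x, (stableM_PW s).sgn_mem n x x.2⟩ = sgnM n (φ x))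
    (n : ℕ) (x : PW s) : φ ⟨relM n x, (stableM_PW s).relM_mem n x.2⟩ = relM n (φ x) := by
  set y : PW s := (1 / 2 : ℂ) • (x + (-1 : ℂ) • ⟨sgnM n x, (stableM_PW s).sgn_mem n x x.2⟩) with hy
  have e : (⟨relM n x, (stableM_PW s).relM_mem n x.2⟩ : PW s) =
      ⟨flipM n y, (stableM_PW s).flip_mem n y y.2⟩ +
        (-(sq n) * (1 / 2)) • (x + ⟨sgnM n x, (stableM_PW s).sgn_mem n x x.2⟩) :=
    Subtype.ext rfl
  rw [e, map_add φ, map_smul φ, map_add φ, hsgn n x, hflip n y, hy, map_smul φ, map_add φ, map_smul φ,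
    hsgn n x]
  rfl

/-- `Hom(W⁰ ⊗ ℂ², Wˢ ⊗ ℂ²) = 0`: an equivariant map `PW 0 → PW sq` vanishes -/
theorem hom_zero_to_sq (φ : ↥(PW 0) →ₗ[ℂ] M) (hmem : ∀ x, φ x ∈ PW sq)
    (hflip : ∀ n (x : PW 0), φ ⟨flipM n x, (stableM_PW 0).flip_mem n x x.2⟩ = flipM n (φ x))
    (hsgn : ∀ n (x : PW 0), φ ⟨sgnM n x, (stableM_PW 0).sgn_mem n x x.2⟩ = sgnM n (φ x))
    (x : PW 0) : φ x = 0 := by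
  obtain ⟨Na, hNa⟩ := exists_level_of_mem_PW x.2
  obtain ⟨Nb, hNb⟩ := exists_level_of_mem_PW (hmem x)
  obtain ⟨n, hn⟩ := Infinite.exists_notMem_finset (Na ∪ Nb)
  have hna : n ∉ Na := fun h => hn (mem_union_left _ h)
  have hnb : n ∉ Nb := fun h => hn (mem_union_right _ h)
  have h := map_relM φ hflip hsgn n x
  have e : (⟨relM n x, (stableM_PW 0).relM_mem n x.2⟩ : PW 0) = (-(sq n)) • x :=
    Subtype.ext ((relM_eq_neg_smul hNa hna).trans (neg_smul _ _).symm)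
  rw [e, map_smul, relM_eq_zero hNb hnb] at h
  exact (smul_eq_zero.1 h).resolve_left (neg_ne_zero.2 (sq_ne_zero n))

/-- `Hom(Wˢ ⊗ ℂ², W⁰ ⊗ ℂ²) = 0`: an equivariant map `PW sq → PW 0` vanishes -/
theorem hom_sq_to_zero (φ : ↥(PW sq) →ₗ[ℂ] M) (hmem : ∀ x, φ x ∈ PW 0)
    (hflip : ∀ n (x : PW sq), φ ⟨flipM n x, (stableM_PW sq).flip_mem n x x.2⟩ = flipM n (φ x))
    (hsgn : ∀ n (x : PW sq), φ ⟨sgnM n x, (stableM_PW sq).sgn_mem n x x.2⟩ = sgnM n (φ x))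
    (x : PW sq) : φ x = 0 := by
  obtain ⟨Na, hNa⟩ := exists_level_of_mem_PW x.2
  obtain ⟨Nb, hNb⟩ := exists_level_of_mem_PW (hmem x)
  obtain ⟨n, hn⟩ := Infinite.exists_notMem_finset (Na ∪ Nb)
  have hna : n ∉ Na := fun h => hn (mem_union_left _ h)
  have hnb : n ∉ Nb := fun h => hn (mem_union_right _ h)
  have h := map_relM φ hflip hsgn n x
  have e : (⟨relM n x, (stableM_PW sq).relM_mem n x.2⟩ : PW sq) = 0 :=
    Subtype.ext (relM_eq_zero hNa hna)
  rw [e, map_zero, relM_eq_neg_smul hNb hnb] at h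
  exact (smul_eq_zero.1 (neg_eq_zero.1 h.symm)).resolve_left (sq_ne_zero n)

end

end Summit.Ventures.HodgeRepro2.Tier7.Line1.Sep
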